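import Summits.ValiantsHypothesis.ValiantsHypothesis.Theorems.LacunarySymmetroidMatrixDescartesCensusDoorA34NullNullEndEdge

/-!
# `MatrixDescartes` census — DOOR A at `(3,4)`: END CONSISTENCY and the NAPPE TEST on the null-null sheet — the two remaining sign-law families of the seat's
# null-null atlas as decidable chamber tests (both singular ends semidefinite must pin the SAME type on each middle letter; nappe law of a hidden-definite middle letter)

HONEST FRAMING.  Object-search cell `pub-symmetroid`, engine seat `val-sym-eng-2` (g5); helper rows beside the registered strata line
`Cruxes/DoorA34/Lines/strata.lean` on stmt-ValiantsHypothesis-19980 (`DoorA34 = PosRootLawAt 3 4 18`: OPEN, typed, never asserted here); third stub `stub_nullNullCeiling`.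
With this file every law family used by the located null-null atlas (L1 end-cell pinning, L2 end pair laws, L3 hidden types + END CONSISTENCY, L4 pinned edges incl.
end edges, L5 nappe) has a general decidable test in the kernel (reading end `S₃ ⪰ 0` or `S₀ ⪰ 0`; the `⪯ 0` readings by `S ↦ −S`):

* `bottom_slot_mul_dotProduct_mulVec_pos_of_nullNull_seventeen_nsd` (`S₀ ⪯ 0` variant of the sign link `c_{00x} ∼ kᵀS_xk`);
* **`card_posRoots_le_16_of_nullNull_consistencyTest`** — `S₃ ⪰ 0` pins the middle letter `x` DEFINITE (orientation + parity) while the semidefinite bottom end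
  (`S₀ ⪰ 0` or `⪯ 0`) says «indefinite» (`t₀·c_{0xx} < 0`) or pins the OPPOSITE sign (`sign c_{00x} ≠ sign c_{33x}`) ⇒ `Z₊ ≤ 16`;
* **`card_posRoots_le_16_of_nullNull_topNappeTest`** — `S₃ ⪰ 0`, `x` hidden-definite of sign `s`, two further letters `y ≠ z` (from `{0,1,2,3} ∖ {x}`) with
  `s·c_{xyy} > 0`, `s·c_{xzz} > 0` but `s·c_{xxy}c_{xxz}c_{xyz} < 0` ⇒ `Z₊ ≤ 16` (`definite_letter_nappe_law`).

Nothing here bounds anything else; `DoorA34` and the three stubs stay OPEN; registers unchanged; nothing on `MatrixDescartes` (stmt-ValiantsHypothesis-18050) or `VP ≠ VNP` —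
VP≠VNP not moved.  [folklore] Descartes bookkeeping; elementary.
-/

-- `Summit.ValiantsHypothesis.ValiantsHypothesis.…` repeats a component by the D-0017 layout
-- (single-conjunct summit), which the `dupNamespace` linter flags; the name is mandated.
set_option linter.dupNamespace false

namespace Summit.ValiantsHypothesis.ValiantsHypothesis.Theorems.LacunarySymmetroidMatrixDescartes.Census

open Polynomial Finset Matrix
open scoped BigOperators Polynomial Matrix

/-- For `3 × 3` matrices `adj(−S) = adj S` (local copy). [folklore] -/
private theorem adjugate_neg_aux4 (S : Matrix (Fin 3) (Fin 3) ℝ) : (-S).adjugate = S.adjugate := by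
  rw [← neg_one_smul ℝ S, Matrix.adjugate_smul]; simp

/-- `S₀ ⪯ 0` variant of the bottom sign link: with kernel vector `k ≠ 0` of `S₀`, `c_{00x} = tr(adj S₀·S_x)` has the sign of `kᵀS_xk` (`x ≠ 0`). [folklore] -/
theorem bottom_slot_mul_dotProduct_mulVec_pos_of_nullNull_seventeen_nsd (d : Fin 4 → ℕ) (hd : StrictMono d) (S : Fin 4 → Matrix (Fin 3) (Fin 3) ℝ)
    (hS : ∀ l, (S l).IsSymm) (h0 : (S 0).det = 0) (h3 : (S 3).det = 0) (hnsd : (-(S 0)).PosSemidef) (h17 : 17 ≤ ((Matrix.det (∑ l, ((X : ℝ[X]) ^ d l) • (S l).map C)).roots.toFinset.filter (fun t => 0 < t)).card)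
    {k : Fin 3 → ℝ} (hk : k ≠ 0) (hPk : S 0 *ᵥ k = 0) {x : Fin 4} (hx : x ≠ 0) :
    0 < ((S 0).adjugate * S x).trace * (k ⬝ᵥ S x *ᵥ k) := by
  have hne := trace_adjugate_mul_ne_zero_of_nullNull_seventeen d hd S h0 h3 h17 0 x hx.symm
  have e := dotProduct_self_mul_trace_adjugate_mul (S 0) (S x) (hS 0) hPk
  have hkk : 0 < k ⬝ᵥ k := lt_of_le_of_ne (by
      simp only [dotProduct, Fin.sum_univ_three]
      nlinarith [mul_self_nonneg (k 0), mul_self_nonneg (k 1), mul_self_nonneg (k 2)])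
    (Ne.symm fun h => hk (dotProduct_self_eq_zero.mp h))
  have htr0 : 0 ≤ (S 0).adjugate.trace := by
    rw [← adjugate_neg_aux4]; exact (adjugate_posSemidef_of_posSemidef hnsd).trace_nonneg
  have htr : 0 < (S 0).adjugate.trace := by
    refine lt_of_le_of_ne htr0 fun h0' => ?_
    rw [← h0', zero_mul] at e
    exact hne ((mul_eq_zero.mp e).resolve_left hkk.ne')
  have e2 : (S 0).adjugate.trace * (((S 0).adjugate * S x).trace * (k ⬝ᵥ S x *ᵥ k)) = (k ⬝ᵥ k) * ((S 0).adjugate * S x).trace ^ 2 := by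
    rw [pow_two, ← mul_assoc (k ⬝ᵥ k), e]; ring
  have hsq : 0 < ((S 0).adjugate * S x).trace ^ 2 := by positivity
  have hpos : 0 < (S 0).adjugate.trace * (((S 0).adjugate * S x).trace * (k ⬝ᵥ S x *ᵥ k)) := by rw [e2]; exact mul_pos hkk hsq
  exact (pos_iff_pos_of_mul_pos hpos).1 htr

/-- **END CONSISTENCY TEST.**  Null-null sheet, `S₃ ⪰ 0`; a middle letter `x` pinned DEFINITE from the top end (orientation `0 < (−1)^{ρ(2d_x+d₃)}·c_{001}`,
`ρ(3d_x) ≡ ρ(2d₃+d_x)`); bottom end semidefinite: `S₀ ⪰ 0 ∧ [c_{0xx} < 0 ∨ ρ(2d₀+d_x) ≢ ρ(2d₃+d_x)]` or `S₀ ⪯ 0 ∧ [c_{0xx} > 0 ∨ ρ(2d₀+d_x) ≢ ρ(2d₃+d_x)]`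
(`c_{0xx}` read as `(−1)^{ρ(2d_x+d₀)}·c_{001}`) ⇒ `Z₊ ≤ 16`. [folklore] -/
theorem card_posRoots_le_16_of_nullNull_consistencyTest (d : Fin 4 → ℕ) (hd : StrictMono d) (S : Fin 4 → Matrix (Fin 3) (Fin 3) ℝ)
    (hS : ∀ l, (S l).IsSymm) (h0 : (S 0).det = 0) (h3 : (S 3).det = 0) (hpsd3 : (S 3).PosSemidef)
    (ρ : ℕ → ℕ) (hρ : ∀ n, ρ n = ((((((Finset.univ : Finset (Sym (Fin 4) 3)).erase (Sym.replicate 3 3)).erase (Sym.replicate 3 0)).image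
          (fun s : Sym (Fin 4) 3 => ((s : Multiset (Fin 4)).map d).sum)).filter (· < n)).card))
    {x : Fin 4} (hx0 : x ≠ 0) (hx3 : x ≠ 3)
    (hor : 0 < (-1 : ℝ) ^ ρ (2 * d x + d 3) * ((S 0).adjugate * S 1).trace)
    (hxdef : (ρ (3 * d x) + ρ (2 * d 3 + d x)) % 2 = 0)
    (hkill : ((S 0).PosSemidef ∧ ((-1 : ℝ) ^ ρ (2 * d x + d 0) * ((S 0).adjugate * S 1).trace < 0 ∨ ρ (2 * d 0 + d x) % 2 ≠ ρ (2 * d 3 + d x) % 2))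
      ∨ ((-(S 0)).PosSemidef ∧ (0 < (-1 : ℝ) ^ ρ (2 * d x + d 0) * ((S 0).adjugate * S 1).trace ∨ ρ (2 * d 0 + d x) % 2 ≠ ρ (2 * d 3 + d x) % 2))) :
    ((Matrix.det (∑ l, ((X : ℝ[X]) ^ d l) • (S l).map C)).roots.toFinset.filter (fun t => 0 < t)).card ≤ 16 := by
  by_contra hlt
  have h17 : 17 ≤ ((Matrix.det (∑ l, ((X : ℝ[X]) ^ d l) • (S l).map C)).roots.toFinset.filter (fun t => 0 < t)).card := by omega
  have hρ' : ∀ n, ρ n = ((Matrix.det (∑ l, ((X : ℝ[X]) ^ d l) • (S l).map C)).support.filter (· < n)).card := fun n => by rw [hρ, sheetRank_eq_of_nullNull_seventeen d S h0 h3 h17]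
  have hqx := top_square_pos_of_orientation_nullNull d hd S h0 h3 h17 hx3 ρ hρ' hor
  obtain ⟨hxd, hxiff⟩ := hiddenDefinite_top_of_parity_nullNull d hd S hS h0 h3 hpsd3 h17 hx0 hx3 ρ hρ' hqx hxdef
  obtain ⟨cTx, mTx⟩ := coeff_square_of_nullNull_seventeen d hd S h0 h3 h17 3 x hx3.symm       -- c_{33x}
  obtain ⟨cq0, mq0⟩ := coeff_square_of_nullNull_seventeen d hd S h0 h3 h17 x 0 hx0            -- c_{0xx} = tr(adj S_x S_0)
  obtain ⟨cT0, mT0⟩ := coeff_square_of_nullNull_seventeen d hd S h0 h3 h17 0 x hx0.symm       -- c_{00x}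
  obtain ⟨c01, m01⟩ := coeff_square_of_nullNull_seventeen d hd S h0 h3 h17 0 1 (by decide)
  have hrank0 := rank_subbottom_of_nullNull_seventeen d hd S h0 h3 h17
  have rq := coeff_mul_coeff_sign_of_nullNull_seventeen d S h0 h3 h17 m01 mq0
  rw [c01, cq0, hrank0, zero_add, ← hρ'] at rq
  have rT := coeff_mul_coeff_sign_of_nullNull_seventeen d S h0 h3 h17 mT0 mTx
  rw [cT0, cTx, ← hρ', ← hρ'] at rT
  have nzq := trace_adjugate_mul_ne_zero_of_nullNull_seventeen d hd S h0 h3 h17 x 0 hx0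
  have nzT3 := trace_adjugate_mul_ne_zero_of_nullNull_seventeen d hd S h0 h3 h17 3 x hx3.symm
  obtain ⟨k, hk, hPk⟩ := Matrix.exists_mulVec_eq_zero_iff.mpr h0
  -- sign of `c_{0xx}` from the orientation
  have sgn_q : ∀ {P : Prop}, ((-1 : ℝ) ^ ρ (2 * d x + d 0) * ((S 0).adjugate * S 1).trace < 0 → ((S x).adjugate * S 0).trace < 0)
      ∧ (0 < (-1 : ℝ) ^ ρ (2 * d x + d 0) * ((S 0).adjugate * S 1).trace → 0 < ((S x).adjugate * S 0).trace) := fun {_} => by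
    constructor
    · intro hk'
      rcases Nat.mod_two_eq_zero_or_one (ρ (2 * d x + d 0)) with p | p
      · have := rq.1 p; rw [neg_one_pow_eq_pow_mod_two, p, pow_zero, one_mul] at hk'; nlinarith [this, hk']
      · have := rq.2 p; rw [neg_one_pow_eq_pow_mod_two, p, pow_one, neg_one_mul, neg_lt_zero] at hk'; nlinarith [this, hk']
    · intro hk'
      rcases Nat.mod_two_eq_zero_or_one (ρ (2 * d x + d 0)) with p | p
      · have := rq.1 p; rw [neg_one_pow_eq_pow_mod_two, p, pow_zero, one_mul] at hk'; nlinarith [this, hk']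
      · have := rq.2 p; rw [neg_one_pow_eq_pow_mod_two, p, pow_one, neg_one_mul, neg_pos] at hk'; nlinarith [this, hk']
  rcases hkill with ⟨hp0, hk'⟩ | ⟨hn0, hk'⟩
  · have rel0 := bottom_slot_mul_dotProduct_mulVec_pos_of_nullNull_seventeen d hd S hS h0 h3 hp0 h17 hk hPk hx0
    rcases hk' with hk' | hpar
    · -- `c_{0xx} < 0`: `x` indefinite from the bottom end — against definiteness
      have hq0 : ((S x).adjugate * S 0).trace < 0 := (sgn_q (P := True)).1 hk'
      obtain ⟨hnP, hnN⟩ := not_definite_of_trace_adjugate_mul_neg hp0 hq0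
      rcases hxd with h | h
      · exact hnP h
      · exact hnN h
    · -- signs of `c_{00x}` and `c_{33x}` differ; but both equal the sign of the definite `S_x`
      have hTT : ((S 0).adjugate * S x).trace * ((S 3).adjugate * S x).trace < 0 := rT.2 (by omega)
      rcases hxd with hP | hN
      · have h1 : 0 < k ⬝ᵥ S x *ᵥ k := by simpa using hP.dotProduct_mulVec_pos hk
        have hT3 : 0 < ((S 3).adjugate * S x).trace := hxiff.mp hP
        nlinarith [rel0, h1, hT3, hTT]
      · have h1 : 0 < k ⬝ᵥ (-S x) *ᵥ k := by simpa using hN.dotProduct_mulVec_pos hk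
        rw [Matrix.neg_mulVec, dotProduct_neg] at h1
        have hT3 : ((S 3).adjugate * S x).trace < 0 := by
          rcases lt_or_gt_of_ne nzT3 with h | h
          · exact h
          · exact absurd (hxiff.mpr h) (not_posDef_of_neg_posDef hN)
        nlinarith [rel0, h1, hT3, hTT]
  · have rel0 := bottom_slot_mul_dotProduct_mulVec_pos_of_nullNull_seventeen_nsd d hd S hS h0 h3 hn0 h17 hk hPk hx0
    rcases hk' with hk' | hpar
    · -- `c_{0xx} > 0` i.e. `tr(adj S_x·(−S₀)) < 0`: indefinite from the bottom end
      have hq0 : 0 < ((S x).adjugate * S 0).trace := (sgn_q (P := True)).2 hk'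
      have hq0' : ((S x).adjugate * (-(S 0))).trace < 0 := by rw [Matrix.mul_neg, Matrix.trace_neg]; linarith
      obtain ⟨hnP, hnN⟩ := not_definite_of_trace_adjugate_mul_neg hn0 hq0'
      rcases hxd with h | h
      · exact hnP h
      · exact hnN h
    · have hTT : ((S 0).adjugate * S x).trace * ((S 3).adjugate * S x).trace < 0 := rT.2 (by omega)
      rcases hxd with hP | hN
      · have h1 : 0 < k ⬝ᵥ S x *ᵥ k := by simpa using hP.dotProduct_mulVec_pos hk
        have hT3 : 0 < ((S 3).adjugate * S x).trace := hxiff.mp hP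
        nlinarith [rel0, h1, hT3, hTT]
      · have h1 : 0 < k ⬝ᵥ (-S x) *ᵥ k := by simpa using hN.dotProduct_mulVec_pos hk
        rw [Matrix.neg_mulVec, dotProduct_neg] at h1
        have hT3 : ((S 3).adjugate * S x).trace < 0 := by
          rcases lt_or_gt_of_ne nzT3 with h | h
          · exact h
          · exact absurd (hxiff.mpr h) (not_posDef_of_neg_posDef hN)
        nlinarith [rel0, h1, hT3, hTT]

/-- **NAPPE TEST on the null-null sheet (top end `S₃ ⪰ 0`).**  `x` middle, hidden-definite (orientation + parity); `y ≠ z` two further letters (`≠ x`; the singular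
ends allowed) with `c_{xyy}`, `c_{xzz}` of the sign of `c_{33x}` but `c_{33x}·c_{xxy}·c_{xxz}·c_{xyz} < 0` (parities) ⇒ `Z₊ ≤ 16`. [folklore] -/
theorem card_posRoots_le_16_of_nullNull_topNappeTest (d : Fin 4 → ℕ) (hd : StrictMono d) (S : Fin 4 → Matrix (Fin 3) (Fin 3) ℝ)
    (hS : ∀ l, (S l).IsSymm) (h0 : (S 0).det = 0) (h3 : (S 3).det = 0) (hpsd3 : (S 3).PosSemidef)
    (ρ : ℕ → ℕ) (hρ : ∀ n, ρ n = ((((((Finset.univ : Finset (Sym (Fin 4) 3)).erase (Sym.replicate 3 3)).erase (Sym.replicate 3 0)).image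
          (fun s : Sym (Fin 4) 3 => ((s : Multiset (Fin 4)).map d).sum)).filter (· < n)).card))
    {x y z : Fin 4} (hx0 : x ≠ 0) (hx3 : x ≠ 3) (hyx : y ≠ x) (hzx : z ≠ x) (hyz : y ≠ z)
    (hor : 0 < (-1 : ℝ) ^ ρ (2 * d x + d 3) * ((S 0).adjugate * S 1).trace)
    (hxdef : (ρ (3 * d x) + ρ (2 * d 3 + d x)) % 2 = 0)
    (hqy : (ρ (2 * d 3 + d x) + ρ (2 * d y + d x)) % 2 = 0) (hqz : (ρ (2 * d 3 + d x) + ρ (2 * d z + d x)) % 2 = 0)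
    (hm : (ρ (2 * d 3 + d x) + ρ (2 * d x + d y) + (ρ (2 * d x + d z) + ρ (d y + d z + d x))) % 2 = 1) :
    ((Matrix.det (∑ l, ((X : ℝ[X]) ^ d l) • (S l).map C)).roots.toFinset.filter (fun t => 0 < t)).card ≤ 16 := by
  by_contra hlt
  have h17 : 17 ≤ ((Matrix.det (∑ l, ((X : ℝ[X]) ^ d l) • (S l).map C)).roots.toFinset.filter (fun t => 0 < t)).card := by omega
  have hρ' : ∀ n, ρ n = ((Matrix.det (∑ l, ((X : ℝ[X]) ^ d l) • (S l).map C)).support.filter (· < n)).card := fun n => by rw [hρ, sheetRank_eq_of_nullNull_seventeen d S h0 h3 h17]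
  have hqx := top_square_pos_of_orientation_nullNull d hd S h0 h3 h17 hx3 ρ hρ' hor
  obtain ⟨hxd, hxiff⟩ := hiddenDefinite_top_of_parity_nullNull d hd S hS h0 h3 hpsd3 h17 hx0 hx3 ρ hρ' hqx hxdef
  obtain ⟨cTx, mTx⟩ := coeff_square_of_nullNull_seventeen d hd S h0 h3 h17 3 x hx3.symm
  obtain ⟨cqy, mqy⟩ := coeff_square_of_nullNull_seventeen d hd S h0 h3 h17 y x hyx
  obtain ⟨cqz, mqz⟩ := coeff_square_of_nullNull_seventeen d hd S h0 h3 h17 z x hzx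
  obtain ⟨cTy, mTy⟩ := coeff_square_of_nullNull_seventeen d hd S h0 h3 h17 x y hyx.symm
  obtain ⟨cTz, mTz⟩ := coeff_square_of_nullNull_seventeen d hd S h0 h3 h17 x z hzx.symm
  obtain ⟨cm, mm⟩ := coeff_mixed_of_nullNull_seventeen d hd S h0 h3 h17 y z x hyz hyx hzx
  have ry := (coeff_mul_coeff_sign_of_nullNull_seventeen d S h0 h3 h17 mTx mqy).1 (by rw [← hρ', ← hρ']; exact hqy)
  have rz := (coeff_mul_coeff_sign_of_nullNull_seventeen d S h0 h3 h17 mTx mqz).1 (by rw [← hρ', ← hρ']; exact hqz)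
  rw [cTx, cqy] at ry; rw [cTx, cqz] at rz
  have r1 := coeff_mul_coeff_sign_of_nullNull_seventeen d S h0 h3 h17 mTx mTy
  have r2 := coeff_mul_coeff_sign_of_nullNull_seventeen d S h0 h3 h17 mTz mm
  rw [cTx, cTy, ← hρ', ← hρ'] at r1; rw [cTz, cm, ← hρ', ← hρ'] at r2
  have hneg : ((S 3).adjugate * S x).trace
      * (((S x).adjugate * S y).trace * ((S x).adjugate * S z).trace * (((S y + S z).adjugate - (S y).adjugate - (S z).adjugate) * S x).trace) < 0 := by
    rcases Nat.mod_two_eq_zero_or_one (ρ (2 * d 3 + d x) + ρ (2 * d x + d y)) with p1 | p1 <;>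
    rcases Nat.mod_two_eq_zero_or_one (ρ (2 * d x + d z) + ρ (d y + d z + d x)) with p2 | p2
    · exfalso; omega
    · nlinarith [r1.1 p1, r2.2 p2]
    · nlinarith [r1.2 p1, r2.1 p2]
    · exfalso; omega
  have hTx := trace_adjugate_mul_ne_zero_of_nullNull_seventeen d hd S h0 h3 h17 3 x hx3.symm
  rcases lt_or_gt_of_ne hTx with hn | hp
  · have hN : (-S x).PosDef := by
      rcases hxd with h | h
      · exact absurd (hxiff.mp h) (not_lt.mpr hn.le)
      · exact h
    have law := definite_letter_nappe_law_neg hN (hS y) (hS z) (by nlinarith [ry, hn]) (by nlinarith [rz, hn])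
    nlinarith [law, hn, hneg]
  · have hPx : (S x).PosDef := hxiff.mpr hp
    have law := definite_letter_nappe_law hPx (hS y) (hS z) (by nlinarith [ry, hp]) (by nlinarith [rz, hp])
    nlinarith [law, hp, hneg]

end Summit.ValiantsHypothesis.ValiantsHypothesis.Theorems.LacunarySymmetroidMatrixDescartes.Census
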